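import Mathlib
import Summits.ValiantsHypothesis.ValiantsHypothesis.Theorems.BarrierLeverSuccinctHittingSetsForVPPrincipalMinorsSmallTwo
import HarnessLib

/-!
# Principal catalecticant minors of size `< n` are hit at the open exponent `b = 2`
(crux stmt-ValiantsHypothesis-14610 side; docket 8745/8749 of seat val-np-p5)

Sharpening of `…PrincipalMinorsSmallTwo` (same witness `Σ_k t^{‖u_k‖²} x^{2u_k}`, same determinant
argument `PrincipalMinorsTwo.exists_eval_det_symbMinor_ne_zero`): the size hypothesis `2|ι| + 2 ≤ n`
becomes `|ι| + 1 ≤ n`, by costing a monomial `x^m` with `|m| - 1` product gates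
(`complexity_monomial_one_le`; the library bound `complexity_monomial_le` is `2|m| + 1`) and each
scaled monomial with one more gate: size `≤ |ι|(n + 1) ≤ n²`.

* `principalMinor_hit_two_of_card_lt` : `u : ι → ℕ^n` injective, `2|u_i| ≤ n`, `|ι| < n` ⇒ some
  `f ∈ SmallCircuits ℂ n 2` has `det [coeff_{u_i+u_j} f] ≠ 0`;
* `principalMinorsLinear_two` : hitting-set form; `not_isNaturalProof_principalMinorLinear`.

Honest framing: 14610-side bookkeeping at the open rung (rank-method minors of size `< n = O(log N)`);
all principal minors with ONE witness are at exponent `3` (`…CatalecticantThree`); nothing here bears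
on `VP ≠ VNP`.

References: [ForbesShpilkaVolk2018] §1.2, Question 6; [Burgisser2000] §2.1.
-/

-- layout Summits/ValiantsHypothesis/ValiantsHypothesis forces the duplicated namespace component
set_option linter.dupNamespace false

noncomputable section

namespace Summit.ValiantsHypothesis.ValiantsHypothesis.Theorems.BarrierLever.SuccinctHittingSetsForVP

open Literature.Barriers.ValiantsHypothesis Literature.Computability.AlgebraicComplexity MvPolynomial

namespace PrincipalMinorsTwo

variable {n : ℕ}

/-- A monomial `x^m` of degree `d + 1` costs at most `d` (product) gates. [cite: Burgisser2000, §2.1] -/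
theorem complexity_monomial_one_le_of_degree (d : ℕ) :
    ∀ m : Fin n →₀ ℕ, m.degree = d + 1 →
      complexity (monomial m (1 : ℂ) : MvPolynomial (Fin n) ℂ) ≤ d := by
  induction d with
  | zero =>
    intro m hm
    obtain ⟨l, hl⟩ : ∃ l, l ∈ m.support := by
      by_contra h
      push Not at h
      have : m = 0 := Finsupp.support_eq_empty.mp (Finset.eq_empty_of_forall_notMem h)
      rw [this, map_zero] at hm
      exact absurd hm (by omega)
    have hle : Finsupp.single l 1 ≤ m := Finsupp.single_le_iff.mpr (Finsupp.mem_support_iff.mp hl |>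
      Nat.pos_of_ne_zero)
    have hsplit : m = (m - Finsupp.single l 1) + Finsupp.single l 1 := (tsub_add_cancel_of_le hle).symm
    have hdeg' : (m - Finsupp.single l 1).degree = 0 := by
      have h := congrArg Finsupp.degree hsplit
      rw [map_add, Finsupp.degree_single, hm] at h
      omega
    have hzero : m - Finsupp.single l 1 = 0 := (Finsupp.degree_eq_zero_iff _).mp hdeg'
    rw [hsplit, hzero, zero_add, ← mul_one (1 : ℂ), ← C_mul_monomial, ← X_pow_eq_monomial, pow_one,
      map_one, one_mul, complexity_X_holds]
  | succ d ih =>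
    intro m hm
    obtain ⟨l, hl⟩ : ∃ l, l ∈ m.support := by
      by_contra h
      push Not at h
      have : m = 0 := Finsupp.support_eq_empty.mp (Finset.eq_empty_of_forall_notMem h)
      rw [this, map_zero] at hm
      exact absurd hm (by omega)
    have hle : Finsupp.single l 1 ≤ m := Finsupp.single_le_iff.mpr (Finsupp.mem_support_iff.mp hl |>
      Nat.pos_of_ne_zero)
    have hsplit : m = (m - Finsupp.single l 1) + Finsupp.single l 1 := (tsub_add_cancel_of_le hle).symm
    have hdeg' : (m - Finsupp.single l 1).degree = d + 1 := by
      have h := congrArg Finsupp.degree hsplit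
      rw [map_add, Finsupp.degree_single, hm] at h
      omega
    rw [hsplit, monomial_add_single, pow_one]
    calc complexity (monomial (m - Finsupp.single l 1) (1 : ℂ) * X l : MvPolynomial (Fin n) ℂ)
        ≤ complexity (monomial (m - Finsupp.single l 1) (1 : ℂ) : MvPolynomial (Fin n) ℂ) +
            complexity (X l : MvPolynomial (Fin n) ℂ) + 1 := complexity_mul_le_holds _ _
      _ ≤ d + 0 + 1 := by
          gcongr
          · exact ih _ hdeg'
          · exact (complexity_X_holds l).le

/-- `L(x^m) ≤ |m| - 1` (natural subtraction). [cite: Burgisser2000, §2.1] -/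
theorem complexity_monomial_one_le (m : Fin n →₀ ℕ) :
    complexity (monomial m (1 : ℂ) : MvPolynomial (Fin n) ℂ) ≤ m.degree - 1 := by
  rcases Nat.eq_zero_or_eq_succ_pred m.degree with h | h
  · have hm : m = 0 := (Finsupp.degree_eq_zero_iff m).mp h
    subst hm
    change complexity (1 : MvPolynomial (Fin n) ℂ) ≤ _
    rw [← C_1, complexity_C_holds]
    exact Nat.zero_le _
  · rw [h, Nat.succ_sub_one]
    exact complexity_monomial_one_le_of_degree _ m h

section Family

variable {ι : Type} [Fintype ι] (u : ι → (Fin n →₀ ℕ))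

/-- The witness is a small circuit of exponent `2` as soon as `2|u_i| ≤ n` and `|ι| + 1 ≤ n`:
size `≤ |ι| · n + |ι| ≤ n²`. [cite: Burgisser2000, §2.1] -/
theorem witness_mem_smallCircuits_of_card_lt (hdeg : ∀ i, 2 * (u i).degree ≤ n)
    (hcard : Fintype.card ι + 1 ≤ n) (t : ℂ) : witness u t ∈ SmallCircuits ℂ n 2 := by
  have hd2 : ∀ k, (2 • u k).degree ≤ n := fun k => by
    rw [map_nsmul, smul_eq_mul]; exact hdeg k
  refine ⟨totalDegree_finsetSum_le fun k _ => (totalDegree_monomial_le _ _).trans (hd2 k), ?_⟩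
  have hterm : ∀ k, complexity (monomial (2 • u k) (t ^ sqNorm (u k)) : MvPolynomial (Fin n) ℂ) ≤ n :=
    fun k => by
      rw [← mul_one (t ^ sqNorm (u k)), ← smul_eq_mul, ← smul_monomial]
      calc complexity ((t ^ sqNorm (u k)) • monomial (2 • u k) (1 : ℂ) : MvPolynomial (Fin n) ℂ)
          ≤ complexity (monomial (2 • u k) (1 : ℂ) : MvPolynomial (Fin n) ℂ) + 1 :=
            complexity_smul_le_holds _ _
        _ ≤ ((2 • u k).degree - 1) + 1 := by gcongr; exact complexity_monomial_one_le _
        _ ≤ n := by have := hd2 k; omega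
  calc complexity (witness u t)
      ≤ ∑ k, complexity (monomial (2 • u k) (t ^ sqNorm (u k)) : MvPolynomial (Fin n) ℂ) +
          (Finset.univ : Finset ι).card := complexity_finset_sum_le _ _
    _ ≤ ∑ _k : ι, n + (Finset.univ : Finset ι).card := by gcongr with k _; exact hterm k
    _ = Fintype.card ι * n + Fintype.card ι := by
        rw [Finset.sum_const, smul_eq_mul, Finset.card_univ]
    _ ≤ n ^ 2 := by nlinarith

end Family

end PrincipalMinorsTwo

open PrincipalMinorsTwo

/-- **Every principal catalecticant minor of size `< n` is hit by `SmallCircuits ℂ n 2`**: for an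
injective family `u : ι → ℕ^n` with `2|u_i| ≤ n` and `|ι| + 1 ≤ n`, some `f` of degree `≤ n` and
size `≤ n²` has `det [coeff_{u_i + u_j} f] ≠ 0`. [cite: ForbesShpilkaVolk2018, §1.2] -/
theorem principalMinor_hit_two_of_card_lt {n : ℕ} {ι : Type} [Fintype ι] [DecidableEq ι]
    (u : ι → (Fin n →₀ ℕ)) (hinj : Function.Injective u) (hdeg : ∀ i, 2 * (u i).degree ≤ n)
    (hcard : Fintype.card ι + 1 ≤ n) :
    ∃ f ∈ SmallCircuits ℂ n 2, (Matrix.of fun i j : ι => MvPolynomial.coeff (u i + u j) f).det ≠ 0 := by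
  obtain ⟨t, ht⟩ := exists_eval_det_symbMinor_ne_zero u hinj
  exact ⟨witness u t, witness_mem_smallCircuits_of_card_lt u hdeg hcard t,
    by rwa [det_coeff_witness]⟩

/-- **Hitting-set form at the open rung**: for every `n`, `SmallCircuits ℂ n 2` is a succinct
hitting set for the polynomials in the coefficient variables whose value at every coefficient
vector is a principal catalecticant minor `det [coeff_{u_i + u_j} f]` with `u` injective,
`2|u_i| ≤ n` and `|ι| + 1 ≤ n`. [cite: ForbesShpilkaVolk2018, §1.2 and Question 6] -/
theorem principalMinorsLinear_two (n : ℕ) :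
    IsSuccinctHittingSet (degLEMonomials n) (SmallCircuits ℂ n 2)
      {D | ∃ (ι : Type) (_ : Fintype ι) (_ : DecidableEq ι) (u : ι → (Fin n →₀ ℕ)),
        Function.Injective u ∧ (∀ i, 2 * (u i).degree ≤ n) ∧ Fintype.card ι + 1 ≤ n ∧
        ∀ f : MvPolynomial (Fin n) ℂ, MvPolynomial.eval (coeffVector (degLEMonomials n) f) D =
          (Matrix.of fun i j : ι => MvPolynomial.coeff (u i + u j) f).det} := by
  intro D hD _
  obtain ⟨ι, _, _, u, hinj, hdeg, hcard, hD⟩ := hD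
  obtain ⟨f, hf, hdet⟩ := principalMinor_hit_two_of_card_lt u hinj hdeg hcard
  exact ⟨f, hf, by rwa [hD f]⟩

/-- … and such a minor is never an algebraically natural proof against `SmallCircuits ℂ n b`,
`b ≥ 2` (`n ≥ 1`). [cite: ForbesShpilkaVolk2018, Thm. 4] -/
theorem not_isNaturalProof_principalMinorLinear {n b : ℕ} (hn : 1 ≤ n) (hb : 2 ≤ b)
    (𝒟 : Set (MvPolynomial (degLEMonomials n) ℂ)) {D : MvPolynomial (degLEMonomials n) ℂ}
    (hD : ∃ (ι : Type) (_ : Fintype ι) (_ : DecidableEq ι) (u : ι → (Fin n →₀ ℕ)),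
      Function.Injective u ∧ (∀ i, 2 * (u i).degree ≤ n) ∧ Fintype.card ι + 1 ≤ n ∧
      ∀ f : MvPolynomial (Fin n) ℂ, MvPolynomial.eval (coeffVector (degLEMonomials n) f) D =
        (Matrix.of fun i j : ι => MvPolynomial.coeff (u i + u j) f).det) :
    ¬ IsNaturalProof (degLEMonomials n) (SmallCircuits ℂ n b) 𝒟 D := by
  rintro ⟨-, hD0, hvan⟩
  obtain ⟨f, hf, hne⟩ := principalMinorsLinear_two n D hD hD0
  exact hne (hvan f (smallCircuits_mono ℂ hb hn hf))

end Summit.ValiantsHypothesis.ValiantsHypothesis.Theorems.BarrierLever.SuccinctHittingSetsForVP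

end
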